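import Mathlib.Combinatorics.SimpleGraph.Walk.Counting
import Mathlib.Combinatorics.SimpleGraph.Paths
import Mathlib.Combinatorics.SimpleGraph.DeleteEdges
import Mathlib.Topology.Algebra.InfiniteSum.ENNReal
import Summits.CriticalPhenomena.SAWScalingLimit.Theorems.SAWTotalPositivityBoundaryTP2Defs
import HarnessLib

/-!
# Crux `BoundaryTP2` (stmt-CriticalPhenomena-7115), line `Sketch`: paths avoiding a vertex

The dictionary "self-avoiding paths of `H` from `a` to `b` that avoid the vertex `c`" = "self-avoiding paths of
the vertex-deleted graph `H - c`", where vertex deletion is Mathlib's `H.deleteEdges (H.incidenceSet c)` (same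
vertex type; `c` becomes isolated), and the resulting identity of path kernels

  `pathKernelOn H x a b {γ | c ∉ γ} = pathKernel (H.deleteEdges (H.incidenceSet c)) x a b`  for `a ≠ c`, `b ≠ c`

(`stub_pathKernelOn_avoid`, a registered stub of the line's skeleton; it is the kernel "A" of the corner
recursion = the kernel of `H - p₃`). Proof: `SimpleGraph.Walk.transfer` in both directions is an equivalence
between the paths of `H` avoiding `c` and the paths of `H.deleteEdges (H.incidenceSet c)` (a walk of the latter
graph between vertices `≠ c` never visits the isolated vertex `c`), it preserves lengths, and the indicator sum
is the sum over the subtype (`tsum_subtype`, `Equiv.tsum_eq`). Everything proved; Mathlib only.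
-/

noncomputable section

namespace Summit.CriticalPhenomena.SAWScalingLimit.Theorems.BoundaryTP2

open scoped ENNReal

variable {V : Type*}

/-- A walk of the vertex-deleted graph `H.deleteEdges (H.incidenceSet c)` between two vertices different from
`c` never visits `c` (the vertex `c` is isolated there). [folklore] -/
private theorem not_mem_support_of_walk_deleteEdges_incidenceSet {H : SimpleGraph V} {c u v : V}
    (p : (H.deleteEdges (H.incidenceSet c)).Walk u v) (hu : u ≠ c) (hv : v ≠ c) : c ∉ p.support := by
  induction p with
  | nil =>
    rw [SimpleGraph.Walk.support_nil, List.mem_singleton]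
    exact fun h => hv h.symm
  | cons h q ih =>
    rw [SimpleGraph.Walk.support_cons, List.mem_cons, not_or]
    refine ⟨fun h' => hu h'.symm, ih ?_ hv⟩
    intro hvc
    rw [SimpleGraph.deleteEdges_adj, SimpleGraph.mk'_mem_incidenceSet_iff] at h
    exact h.2 ⟨h.1, Or.inr hvc.symm⟩

/-- The edges of a walk of `H` avoiding the vertex `c` are edges of `H.deleteEdges (H.incidenceSet c)`.
[folklore] -/
private theorem edges_mem_edgeSet_deleteEdges_incidenceSet {H : SimpleGraph V} {c u v : V}
    (p : H.Walk u v) (hc : c ∉ p.support) :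
    ∀ e, e ∈ p.edges → e ∈ (H.deleteEdges (H.incidenceSet c)).edgeSet := by
  intro e he
  rw [SimpleGraph.edgeSet_deleteEdges]
  exact ⟨p.edges_subset_edgeSet he,
    fun hinc => hc (SimpleGraph.Walk.mem_support_of_mem_edges he hinc.2)⟩

/-- The edges of a walk of `H.deleteEdges s` are edges of `H`. [folklore] -/
private theorem edges_mem_edgeSet_of_walk_deleteEdges {H : SimpleGraph V} {s : Set (Sym2 V)} {u v : V}
    (p : (H.deleteEdges s).Walk u v) : ∀ e, e ∈ p.edges → e ∈ H.edgeSet :=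
  fun _ he => SimpleGraph.edgeSet_mono (SimpleGraph.deleteEdges_le s) (p.edges_subset_edgeSet he)

/-- **Paths avoiding a vertex are the paths of the vertex-deleted graph** (registered stub
`stub_pathKernelOn_avoid` of the line `Sketch` of crux `BoundaryTP2`): for `a ≠ c` and `b ≠ c`,
`Σ_{γ : a → b s.a. path of H, c ∉ γ} x^{|γ|} = Z_{H - c}^x(a, b)`, where `H - c` is
`H.deleteEdges (H.incidenceSet c)`. The two path sets are in length-preserving bijection via
`SimpleGraph.Walk.transfer`. [folklore] -/
theorem stub_pathKernelOn_avoid (H : SimpleGraph V) (x : ℝ) (a b c : V) (ha : a ≠ c) (hb : b ≠ c) :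
    pathKernelOn H x a b {γ | c ∉ γ.1.support} = pathKernel (H.deleteEdges (H.incidenceSet c)) x a b := by
  set S : Set (H.Path a b) := {γ | c ∉ γ.1.support}
  let e : S ≃ (H.deleteEdges (H.incidenceSet c)).Path a b :=
    { toFun := fun γ =>
        ⟨γ.1.1.transfer _ (edges_mem_edgeSet_deleteEdges_incidenceSet γ.1.1 γ.2), γ.1.2.transfer _⟩
      invFun := fun δ =>
        ⟨⟨δ.1.transfer H (edges_mem_edgeSet_of_walk_deleteEdges δ.1), δ.2.transfer _⟩, by
          simp only [S, Set.mem_setOf_eq, SimpleGraph.Walk.support_transfer]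
          exact not_mem_support_of_walk_deleteEdges_incidenceSet δ.1 ha hb⟩
      left_inv := fun γ => Subtype.ext <| Subtype.ext <| by
        simp only [SimpleGraph.Walk.transfer_transfer, SimpleGraph.Walk.transfer_self]
      right_inv := fun δ => Subtype.ext <| by
        simp only [SimpleGraph.Walk.transfer_transfer, SimpleGraph.Walk.transfer_self] }
  calc pathKernelOn H x a b S
      = ∑' γ : S, ENNReal.ofReal (x ^ γ.1.1.length) :=
        (tsum_subtype S (fun γ : H.Path a b => ENNReal.ofReal (x ^ γ.1.length))).symm
    _ = ∑' γ : S, ENNReal.ofReal (x ^ (e γ).1.length) := by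
        refine tsum_congr fun γ => ?_
        rw [show (e γ).1.length = γ.1.1.length from SimpleGraph.Walk.length_transfer _ _]
    _ = ∑' δ : (H.deleteEdges (H.incidenceSet c)).Path a b, ENNReal.ofReal (x ^ δ.1.length) :=
        Equiv.tsum_eq e (fun δ => ENNReal.ofReal (x ^ δ.1.length))
    _ = pathKernel (H.deleteEdges (H.incidenceSet c)) x a b := rfl

end Summit.CriticalPhenomena.SAWScalingLimit.Theorems.BoundaryTP2
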